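import Literature.NumberTheory.Automorphic.UnboundedDenominatorsInvariantHomPrimePowerOdd
import Literature.GroupTheory.ArithmeticGroups.SL2PrimePowSchurMultiplierOddPGroup
import HarnessLib

/-!
# The invariant form of CDT Cor. 4.5.3: ALL odd block certificates (`p` odd, any depth `e`, targets of
# `p`-power exponent)

`UnboundedDenominatorsInvariantHomPrimePowerOdd` gave the local condition at `ℓ = p` odd for targets of
exponent `p`.  Using Beyl's theorem for `p`-group kernels of any exponent (`SL2SchurMultiplierOddPGroup`, via
the Hopf-formula exponent lift `CentralExtensionExponentLift`), the same local condition holds for targets of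
exponent `p^a` (`local_condition_primePow_odd_pgroup`), and `block_certificate_primePow_odd` states it in the
exact shape of the «odd block certificates» consumed by the K★ assembly
`HcorBlocks.cor453_invariant_form_of_odd_block_certificates` (level `m' * p^e`).  With it, the `hcert`
hypothesis of that assembly is discharged outright: the invariant form of
[CalegariDimitrovTang2025, Corollary 4.5.3] holds for every level `N` with `4 ∤ N`; the only residue is the
`2`-adic one (`4 ∣ N`, where `M(SL₂(ℤ/2^e)) = ℤ/2`).  [Beyl1986]
-/

open scoped MatrixGroups

namespace Literature.NumberTheory.Automorphic

namespace UnboundedDenominators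

open CongruenceSubgroup Matrix.SpecialLinearGroup
open Literature.GroupTheory.ArithmeticGroups

variable {Q : Type*} [CommGroup Q]

/-- **The local condition at `ℓ = p` ODD for the factor `SL₂(ℤ/p^e)` of `SL₂(ℤ/N)`, `N = p^e M`, `p ∤ M`,
targets of `p`-POWER exponent** (any `p^a`, all odd `p` including `p = 3`): for an `SL₂(ℤ)`-invariant
`θ : Γ(p^e M) → Q`, `θ` kills `Γ(N) ∩ ([Γ(M), Γ(M)]·K_θ)`.  Same proof as `local_condition_primePow_odd`,
ending with `SL2SchurMultiplierOddPGroup.eq_one_of_mem_ker_of_mem_commutator_odd_pgroup` (Beyl's theorem for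
`p`-group kernels, obtained from the exponent-`p` case by the Hopf-formula exponent lift).
[cite: Beyl1986, Theorem (M(SL(2,ℤ/m)) = 0 for 4 ∤ m), p-primary part] -/
theorem local_condition_primePow_odd_pgroup {p e M a : ℕ} [Fact p.Prime] (hp2 : p ≠ 2) (hM : p.Coprime M)
    (hQ : ∀ q : Q, q ^ (p ^ a) = 1) (θ : Gamma (p ^ e * M) →* Q)
    (hθ : ∀ (g x : SL(2, ℤ)) (hx : x ∈ Gamma (p ^ e * M)) (hgx : g * x * g⁻¹ ∈ Gamma (p ^ e * M)),
      θ ⟨g * x * g⁻¹, hgx⟩ = θ ⟨x, hx⟩) :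
    ∀ (y : SL(2, ℤ)) (hy : y ∈ Gamma (p ^ e * M)),
      y ∈ ⁅Gamma M, Gamma M⁆ ⊔ θ.ker.map (Gamma (p ^ e * M)).subtype → θ ⟨y, hy⟩ = 1 := by
  intro y hy hyc
  have hp : p.Prime := Fact.out
  have hNM : Gamma (p ^ e * M) ≤ Gamma M := Wohlfahrt.Gamma_le_Gamma_of_dvd (dvd_mul_left M (p ^ e))
  have hNp : Gamma (p ^ e * M) ≤ Gamma (p ^ e) := Wohlfahrt.Gamma_le_Gamma_of_dvd (dvd_mul_right (p ^ e) M)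
  have hcopM : (p ^ e).Coprime M := Nat.Coprime.pow_left e hM
  haveI hKn : (θ.ker.map (Gamma (p ^ e * M)).subtype).Normal := ker_map_subtype_normal θ hθ
  haveI : ((θ.ker.map (Gamma (p ^ e * M)).subtype).subgroupOf (Gamma M)).Normal := inferInstance
  -- the reduction and the central extension
  have hK'ρ : (θ.ker.map (Gamma (p ^ e * M)).subtype).subgroupOf (Gamma M) ≤
      ((Matrix.SpecialLinearGroup.map (n := Fin 2) (Int.castRingHom (ZMod (p ^ e)))).comp
        (Gamma M).subtype).ker := by
    intro g hg
    obtain ⟨hgN, -⟩ := (mem_subgroupOf_ker_iff θ g).mp hg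
    rw [MonoidHom.mem_ker, MonoidHom.comp_apply, Subgroup.coe_subtype, ← Gamma_mem']
    exact hNp hgN
  let π : Gamma M ⧸ (θ.ker.map (Gamma (p ^ e * M)).subtype).subgroupOf (Gamma M) →* SL(2, ZMod (p ^ e)) :=
    QuotientGroup.lift _ _ hK'ρ
  have hπmk : ∀ g : Gamma M, π (QuotientGroup.mk g) =
      Matrix.SpecialLinearGroup.map (Int.castRingHom (ZMod (p ^ e))) (g : SL(2, ℤ)) := fun g ↦ rfl
  -- surjective
  have hsurj : Function.Surjective π := by
    intro X
    haveI : NeZero (p ^ e) := ⟨pow_ne_zero _ hp.ne_zero⟩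
    obtain ⟨B, hB⟩ :=
      Literature.NumberTheory.EllipticCurves.ModularForms.specialLinearGroup_map_surjective (p ^ e) X
    obtain ⟨γ, hγ, hγB⟩ := IharaAmalgam.exists_mem_Gamma_forall_dvd_sub hcopM.symm B
    refine ⟨QuotientGroup.mk ⟨γ, hγ⟩, ?_⟩
    rw [hπmk, ← hB]
    exact map_eq_map_of_forall_dvd_sub (by exact_mod_cast hγB)
  -- kernel elements lie over Γ(N)
  have hkerN : ∀ g : Gamma M, π (QuotientGroup.mk g) = 1 → (g : SL(2, ℤ)) ∈ Gamma (p ^ e * M) := by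
    intro g hg
    rw [hπmk, ← Gamma_mem'] at hg
    exact mem_Gamma_mul_of_coprime hcopM hg g.2
  have hcen : ∀ z, π z = 1 → ∀ g, g * z = z * g := by
    intro z hz g
    induction z using QuotientGroup.induction_on with
    | H x =>
      induction g using QuotientGroup.induction_on with
      | H y =>
        rw [← QuotientGroup.mk_mul, ← QuotientGroup.mk_mul, QuotientGroup.eq]
        exact comm_mem_subgroupOf_ker θ hθ x y (hkerN x hz)
  have hexp : ∀ z, π z = 1 → z ^ (p ^ a) = 1 := by
    intro z hz
    induction z using QuotientGroup.induction_on with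
    | H x =>
      rw [← QuotientGroup.mk_pow, QuotientGroup.eq_one_iff]
      exact pow_mem_subgroupOf_ker θ hQ x (hkerN x hz)
  -- decompose y = c * k
  obtain ⟨c, hc, k, hk, hck⟩ := Subgroup.mem_sup_of_normal_right.mp hyc
  haveI : (Gamma M).Normal := Gamma_normal M
  have hcM : c ∈ Gamma M := (Subgroup.commutator_le_left (Gamma M) (Gamma M)) hc
  obtain ⟨hkN, hk1⟩ := (mem_ker_map_subtype_iff θ).mp hk
  have hkM : k ∈ Gamma M := hNM hkN
  have hyM : y ∈ Gamma M := hNM hy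
  have hcls : (QuotientGroup.mk (⟨y, hyM⟩ : Gamma M) :
      Gamma M ⧸ (θ.ker.map (Gamma (p ^ e * M)).subtype).subgroupOf (Gamma M)) = QuotientGroup.mk ⟨c, hcM⟩ := by
    have : (⟨y, hyM⟩ : Gamma M) = ⟨c, hcM⟩ * ⟨k, hkM⟩ :=
      Subtype.ext (by rw [Subgroup.coe_mul]; exact hck.symm)
    rw [this, QuotientGroup.mk_mul]
    have hk' : (⟨k, hkM⟩ : Gamma M) ∈ (θ.ker.map (Gamma (p ^ e * M)).subtype).subgroupOf (Gamma M) :=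
      (mem_subgroupOf_ker_iff θ _).mpr ⟨hkN, hk1⟩
    rw [(QuotientGroup.eq_one_iff _).mpr hk', mul_one]
  have hcomm : (QuotientGroup.mk (⟨c, hcM⟩ : Gamma M) :
      Gamma M ⧸ (θ.ker.map (Gamma (p ^ e * M)).subtype).subgroupOf (Gamma M)) ∈ commutator _ := by
    have h1 : (⟨c, hcM⟩ : Gamma M) ∈ commutator (Gamma M) := by
      have h2 : (commutator (Gamma M)).map (Gamma M).subtype = ⁅Gamma M, Gamma M⁆ := by
        rw [commutator_def, Subgroup.map_commutator, ← MonoidHom.range_eq_map, Subgroup.range_subtype]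
      rw [← h2] at hc
      obtain ⟨c', hc', hcc'⟩ := hc
      have : c' = ⟨c, hcM⟩ := Subtype.ext hcc'
      rwa [this] at hc'
    have := Subgroup.mem_map_of_mem (QuotientGroup.mk' ((θ.ker.map (Gamma (p ^ e * M)).subtype).subgroupOf
      (Gamma M))) h1
    rw [commutator_def, Subgroup.map_commutator] at this
    rw [commutator_def]
    exact Subgroup.commutator_mono le_top le_top this
  have hπy : π (QuotientGroup.mk (⟨y, hyM⟩ : Gamma M)) = 1 := by
    rw [hπmk, ← Gamma_mem']
    exact hNp hy
  rw [hcls] at hπy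
  have key := SL2SchurMultiplierOddPGroup.eq_one_of_mem_ker_of_mem_commutator_odd_pgroup p hp2 e a π hsurj hcen
    hexp hπy hcomm
  rw [← hcls, QuotientGroup.eq_one_iff, mem_subgroupOf_ker_iff] at key
  obtain ⟨_, h⟩ := key
  exact h


/-- **Block certificate at `p^e` (`p` odd, any `e`, targets of `p`-power exponent)** in the exact shape consumed
by the tree's `HcorBlocks.cor453_invariant_form_of_odd_block_certificates` (level written `m' * p^e`): every
odd block certificate holds.
[cite: Beyl1986, Theorem (M(SL(2,ℤ/m)) = 0 for 4 ∤ m), p-primary part] -/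
theorem block_certificate_primePow_odd {p e m' a : ℕ} [Fact p.Prime] (hp2 : p ≠ 2) (hm' : m'.Coprime p)
    (Q : Type*) [CommGroup Q] (hQ : ∀ q : Q, q ^ (p ^ a) = 1) (θ : Gamma (m' * p ^ e) →* Q)
    (hθ : ∀ (g x : SL(2, ℤ)) (hx : x ∈ Gamma (m' * p ^ e)) (hgx : g * x * g⁻¹ ∈ Gamma (m' * p ^ e)),
      θ ⟨g * x * g⁻¹, hgx⟩ = θ ⟨x, hx⟩) :
    ∀ (y : SL(2, ℤ)) (hy : y ∈ Gamma (m' * p ^ e)),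
      y ∈ ⁅Gamma m', Gamma m'⁆ ⊔ θ.ker.map (Gamma (m' * p ^ e)).subtype → θ ⟨y, hy⟩ = 1 := by
  have h : m' * p ^ e = p ^ e * m' := mul_comm _ _
  revert θ
  rw [h]
  intro θ hθ
  exact local_condition_primePow_odd_pgroup hp2 hm'.symm hQ θ hθ

end UnboundedDenominators

end Literature.NumberTheory.Automorphic
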